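import Summits.QuantumFields.YangMills.Theses.RecentredCoverTransfer
import Summits.QuantumFields.YangMills.Theorems.RecentredCoverTransferCellDLRMeasurable
import Summits.QuantumFields.YangMills.Theorems.RecentredCoverTransferOnePointRateOfBoundaryLaw
import Summits.QuantumFields.YangMills.Theorems.BalabanLadderROTTiltBracketKernel
import HarnessLib

/-!
# Route `RecentredCoverTransfer` (LINE g9-B′ of planner ym-idea-1 g9), support item `PointwiseTransferOfProductLaw` (stmt-QuantumFields-23256)

`ProductBoundaryLaw →` the POINTWISE MOMENT TRANSFER: for every `n, K, δ, ε > 0`, eventually in `k`, for all `n` sites `x_i ∈ box(L_k)`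
with `‖a_k x_i‖ ≤ K` and pairwise physical sup-distance `≥ δ`,
`|E_{C_k}[Π_i (d_{x_i}∘lift − m_T(k))] − E_{T_k}[Π_i (d_{x_i}∘torusLift − m_T(k))]| ≤ ε·a_k^{4n}` — the DLR SANDWICH:

* cube `(c, b) = (−N·1, 2N+1)` with `N = ⌈T/a_k⌉₊`, `T = ℓ₁ + 2|K| + 1`: it has physical side `≥ ℓ₁`, contains every `x_i` (and `0`) in
  its middle half (`le_depth_cube`), fits the torus (`N + 3 ≤ L_k`, `ceil_add_three_le` once `T a_k < 1/2`) and its 2-window injects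
  modulo `(2L_k+1)·D₄` (`window_injective_of_period`);
* clause (1) of `ProductBoundaryLaw` at `x = 0` and the torus one-cube transfer (`abs_torusE_sub_le_of_kernel`) give `|m_T − p(β_k)| ≤ a_k⁴`,
  so clause (2) applies with `m = m_T`: the cube-kernel means of `Π = ∏_i (d_{x_i} − m_T)` oscillate by `≤ (ε/2)·a_k^{4n}` in the
  exterior;
* the torus mean (`abs_torusE_sub_le_of_kernel`) and the cell mean (the one-cube DLR identity of the cell,
  `integral_kerE_cellLift_eq` = item `CellCubeDLR`, then `abs_integral_cellLift_sub_le_of_kernel`) are both within `(ε/2)·a_k^{4n}` of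
  the kernel mean at one fixed exterior, hence within `ε·a_k^{4n}` of each other.

Width seat ym-line-sfw-p2-w3 g28 (cell ym-idea-1; free hands).  THEOREMS ONLY.  HONEST FRAMING: `ProductBoundaryLaw` (23255, XL-IR) is OPEN;
no crux, no rung (R2d ROT is a RECORD rung), no summit; the Yang–Mills mass gap is NOT proved by any of this.
-/

set_option autoImplicit false

noncomputable section

open scoped SchwartzMap BigOperators ENNReal
open MeasureTheory Filter Topology
open Literature.MathematicalPhysics.QuantumFieldTheory Literature.MathematicalPhysics.QuantumLattice
open Literature.MathematicalPhysics.AQFT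
open Literature.Probability.LatticeModels (Site box mem_box)
open Summit.QuantumFields.YangMills.Theorems.ROT (PeriodCell)
open Summit.QuantumFields.YangMills.Cruxes.OSLegsFromFemtoAndGap.DlrCollarTransfer (kerE depth torusE dens)
open Summit.QuantumFields.YangMills.Cruxes.OSLegsFromFemtoAndGap.DlrCollarTransfer.StubLower (le_depth_cube)
open Summit.QuantumFields.YangMills.Cruxes.NT.BoundaryLaw (abs_torusE_sub_le_of_kernel succ_le_depth_centre)
open Summit.QuantumFields.YangMills.Theorems.OSLegsFromFemtoAndGap.StubLower (curvature_shift_supp_window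
  isCylinder_curvature_shift continuous_curvature_shift)
open Summit.QuantumFields.YangMills.Theorems.OSLegsFromFemtoAndGap (torusE_dens_eq_wilsonTorusMean mul_norm_le_norm_smul_siteToE)

namespace Summit.QuantumFields.YangMills.Theorems.RecentredCoverTransfer

/-! ## §1 Two small bounds -/

section Bounds

variable {G : Type} [Group G] [TopologicalSpace G] [IsTopologicalGroup G] [CompactSpace G]
  [MeasurableSpace G] [BorelSpace G]

/-- The torus mean of an observable bounded by `B` is bounded by `B`. [folklore] -/
theorem abs_wilsonTorusMean_le (r : LatticeRep G) (β : ℝ) (L : ℕ) {O : LGConfig 4 G → ℝ} {B : ℝ}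
    (hB : ∀ V, |O V| ≤ B) : |wilsonTorusMean r.ρ β L O| ≤ B := by
  haveI := isProbabilityMeasure_wilsonMeasure (d := 4) (L := 2 * L + 1) r.ρ r.continuous β
  unfold wilsonTorusMean
  have h := norm_integral_le_of_norm_le_const (μ := wilsonMeasure (d := 4) (L := 2 * L + 1) r.ρ β)
    (f := fun U => O (torusLift (2 * L + 1) U)) (C := B) (ae_of_all _ fun U => by rw [Real.norm_eq_abs]; exact hB _)
  rwa [Real.norm_eq_abs, probReal_univ, mul_one] at h

/-- The product of `n` translated, centred action densities is bounded by `(2B)ⁿ` when `|d| ≤ B` and `|m| ≤ B`. [folklore] -/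
theorem abs_prod_curvature_shift_le (r : LatticeRep G) {B m : ℝ} (hB : ∀ V, |r.curvature.F V| ≤ B) (hm : |m| ≤ B)
    {n : ℕ} (x : Fin n → Site 4) (U : LGConfig 4 G) :
    |∏ i, (r.curvature.F (configShift (-(x i)) U) - m)| ≤ (2 * B) ^ n := by
  rw [Finset.abs_prod]
  calc ∏ i, |r.curvature.F (configShift (-(x i)) U) - m|
      ≤ ∏ _i : Fin n, (2 * B) := Finset.prod_le_prod (fun _ _ => abs_nonneg _) fun i _ =>
        (abs_sub _ _).trans (by linarith [hB (configShift (-(x i)) U)])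
    _ = (2 * B) ^ n := by simp

end Bounds

/-! ## §2 The pointwise moment transfer -/

/-- **Item stmt-QuantumFields-23256 `RecentredCoverTransfer.PointwiseTransferOfProductLaw` holds**: `ProductBoundaryLaw →` pointwise
moment transfer (the DLR sandwich of the module docstring). [folklore] -/
theorem pointwiseTransferOfProductLaw_proof :
    Summit.QuantumFields.YangMills.Theses.RecentredCoverTransfer.PointwiseTransferOfProductLaw := by
  intro hPBL G _ _ _ _ hG
  letI : MeasurableSpace G := borel G
  haveI : BorelSpace G := ⟨rfl⟩
  intro r a ha ha0 hMB sch hsch C hC n K δ ε hδ hε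
  haveI := r.secondCountableTopology
  obtain ⟨B, hB⟩ := r.curvature.bounded
  -- the boundary law at precision `ε₁ = min (ε/2) 1`
  set ε₁ : ℝ := min (ε / 2) 1 with hε₁
  have hε₁pos : 0 < ε₁ := lt_min (by positivity) one_pos
  have hε₁ε : ε₁ ≤ ε / 2 := min_le_left _ _
  have hε₁1 : ε₁ ≤ 1 := min_le_right _ _
  obtain ⟨β₁, ℓ₁, p, hℓ₁, H⟩ := hPBL G hG r a ha ha0 ε₁ hε₁pos δ hδ n
  -- the physical radius of the transfer cube
  set T : ℝ := ℓ₁ + 2 * |K| + 1 with hT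
  have hTpos : 0 < T := by positivity
  have hβ : Tendsto sch.β atTop atTop := hsch.2.1
  have E1 : ∀ᶠ k in atTop, β₁ ≤ sch.β k := hβ.eventually_ge_atTop β₁
  have E2 : ∀ᶠ k in atTop, sch.a k < 1 / (2 * T) := (tendsto_order.1 sch.tendsto_a).2 _ (by positivity)
  filter_upwards [E1, E2] with k hk1 hk2 x hxbox hxK hsep
  obtain ⟨-, hα24, -, hLk⟩ := hsch.2.2 k
  have haeq : sch.a k = a (sch.β k) := hsch.1 k
  have hα : 0 < sch.a k := sch.a_pos k
  have hα1 : sch.a k ≤ 1 := hα24.trans (by norm_num)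
  have hTα : T * sch.a k < 1 / 2 := by
    have := (lt_div_iff₀ (by positivity : (0 : ℝ) < 2 * T)).1 hk2
    linarith
  -- the cube `(−N, 2N+1)`
  set N : ℕ := ⌈T / sch.a k⌉₊ with hNdef
  have hNT : T / sch.a k ≤ N := Nat.le_ceil _
  have hNT' : T ≤ N * sch.a k := by rwa [div_le_iff₀ hα] at hNT
  have hNL : N + 3 ≤ sch.L k := ceil_add_three_le hα hα24 hTpos hTα hLk
  have hN1L : N + 1 ≤ sch.L k := by omega
  have hb5 : (2 * N + 1) + 5 ≤ 2 * sch.L k + 1 := by omega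
  have hℓb : ℓ₁ ≤ ((2 * N + 1 : ℕ) : ℝ) * a (sch.β k) := by
    rw [← haeq]
    have h2 : (N : ℝ) * sch.a k ≤ ((2 * N + 1 : ℕ) : ℝ) * sch.a k := by
      apply mul_le_mul_of_nonneg_right _ hα.le
      push_cast; linarith
    linarith [hT, abs_nonneg K]
  -- coordinates of the sites: `|x i j| ≤ |K| / a ≤ N − 1`
  have hKa : |K| / sch.a k + 1 ≤ N := by
    have h1 : (2 * |K| + 1) / sch.a k ≤ T / sch.a k :=
      div_le_div_of_nonneg_right (by rw [hT]; linarith) hα.le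
    have h2 : (2 * |K| + 1) / sch.a k = 2 * (|K| / sch.a k) + 1 / sch.a k := by
      field_simp
    have h3 : 1 ≤ 1 / sch.a k := by rw [le_div_iff₀ hα]; linarith
    have h4 : 0 ≤ |K| / sch.a k := by positivity
    linarith
  have hxr : ∀ i j, |((x i j : ℤ) : ℝ)| ≤ |K| / sch.a k := fun i j => by
    rw [le_div_iff₀ hα, mul_comm]
    calc sch.a k * |((x i j : ℤ) : ℝ)| ≤ sch.a k * ‖x i‖ := by
          refine mul_le_mul_of_nonneg_left ?_ hα.le
          have h := norm_le_pi_norm (x i) j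
          rwa [Int.norm_eq_abs] at h
      _ ≤ ‖sch.a k • siteToE (x i)‖ := mul_norm_le_norm_smul_siteToE hα.le (x i)
      _ ≤ K := hxK i
      _ ≤ |K| := le_abs_self K
  have hxN : ∀ i j, |x i j| ≤ (N : ℤ) - 1 := fun i j => by
    have h : ((|x i j| : ℤ) : ℝ) ≤ ((N : ℤ) : ℝ) - 1 := by
      rw [Int.cast_abs, Int.cast_natCast]
      linarith [hxr i j]
    exact_mod_cast h
  -- every site, and the origin, lies in the middle half of the cube
  have hdepth : ∀ i, 2 * N + 1 ≤ 4 * depth (fun j => (0 : Fin 4 → ℤ) j - N) (2 * N + 1) (x i) := fun i => by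
    have h := le_depth_cube (0 : Fin 4 → ℤ) (x i) N (t := |K| / sch.a k) (fun j => by simpa using hxr i j)
    have h2 : 2 * (|K| / sch.a k) ≤ N := by
      have h1 : 2 * |K| / sch.a k ≤ T / sch.a k := div_le_div_of_nonneg_right (by rw [hT]; linarith) hα.le
      rw [mul_div_assoc] at h1
      exact h1.trans hNT
    have h3 : ((2 * N + 1 : ℕ) : ℝ) ≤ ((4 * depth (fun j => (0 : Fin 4 → ℤ) j - N) (2 * N + 1) (x i) : ℕ) : ℝ) := by
      push_cast; linarith
    exact_mod_cast h3
  have hdepth0 : 2 * N + 1 ≤ 4 * depth (fun j => (0 : Fin 4 → ℤ) j - N) (2 * N + 1) 0 := by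
    have := succ_le_depth_centre (0 : Fin 4 → ℤ) N
    omega
  -- the boundary law at `β_k` on this cube
  obtain ⟨H1, H2⟩ := H (sch.β k) hk1 (fun j => (0 : Fin 4 → ℤ) j - N) (2 * N + 1) hℓb
  -- `|m_T − p β| ≤ a⁴` by clause (1) at the origin and the torus one-cube transfer
  have hmT : |wilsonTorusMean r.ρ (sch.β k) (sch.L k) r.curvature.F - p (sch.β k)| ≤ (a (sch.β k)) ^ 4 := by
    have hker0 : ∀ η : LGConfig 4 G, |kerE G r (sch.β k) (fun j => (0 : Fin 4 → ℤ) j - N) (2 * N + 1) η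
        (fun U => r.curvature.F (configShift (-(0 : Fin 4 → ℤ)) U)) - p (sch.β k)| ≤ ε₁ * (a (sch.β k)) ^ 4 :=
      fun η => H1 η 0 hdepth0
    have h := abs_torusE_sub_le_of_kernel G r (sch.β k) 0 N (sch.L k) hN1L (continuous_curvature_shift r 0)
      (fun U => hB _) (isCylinder_curvature_shift r 0) (fun e he j => by
        have hw := curvature_shift_supp_window r 0 e he j
        have hN1 : (1 : ℤ) ≤ N := by
          have := hKa; have h0 : 0 ≤ |K| / sch.a k := by positivity
          exact_mod_cast (show (1 : ℝ) ≤ N by linarith)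
        simp only [Pi.zero_apply] at hw ⊢
        constructor <;> omega) hker0
    have e := torusE_dens_eq_wilsonTorusMean (G := G) r (sch.β k) (sch.L k) 0
    rw [← e]
    exact h.trans (by nlinarith [pow_pos (ha (sch.β k)) 4])
  -- the product observable
  have hmTB : |wilsonTorusMean r.ρ (sch.β k) (sch.L k) r.curvature.F| ≤ B := abs_wilsonTorusMean_le r _ _ hB
  have hPc := Summit.QuantumFields.YangMills.Theorems.ROT.PeriodCell.continuous_prod_curvature_shift r (wilsonTorusMean r.ρ (sch.β k) (sch.L k) r.curvature.F) x
  have hPb : ∀ U : LGConfig 4 G, |∏ i, (r.curvature.F (configShift (-(x i)) U) -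
      wilsonTorusMean r.ρ (sch.β k) (sch.L k) r.curvature.F)| ≤ (2 * B) ^ n :=
    fun U => abs_prod_curvature_shift_le r hB hmTB x U
  have hPcyl := Summit.QuantumFields.YangMills.Theorems.ROT.PeriodCell.isCylinder_prod_curvature_shift r
    (wilsonTorusMean r.ρ (sch.β k) (sch.L k) r.curvature.F) x
  have hwinT : ∀ e ∈ (Finset.univ.biUnion fun i => r.curvature.supp.image fun e => (e.1 + x i, e.2)), ∀ j,
      (0 : Fin 4 → ℤ) j - N ≤ e.1 j ∧ e.1 j ≤ (0 : Fin 4 → ℤ) j + N := by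
    intro e he j
    obtain ⟨i, -, hi⟩ := Finset.mem_biUnion.1 he
    have hw := curvature_shift_supp_window r (x i) e hi j
    have hx := abs_le.1 (hxN i j)
    simp only [Pi.zero_apply]
    constructor <;> omega
  have hwinC : ∀ e ∈ (Finset.univ.biUnion fun i => r.curvature.supp.image fun e => (e.1 + x i, e.2)), ∀ j,
      (fun j => (0 : Fin 4 → ℤ) j - (N : ℤ)) j ≤ e.1 j ∧ e.1 j ≤ (fun j => (0 : Fin 4 → ℤ) j - (N : ℤ)) j + ((2 * N + 1 : ℕ) : ℤ) := by
    intro e he j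
    have h := hwinT e he j
    simp only [Pi.zero_apply] at h ⊢
    push_cast
    constructor <;> omega
  -- clause (2): the kernel means of the product oscillate by `≤ ε₁ a^{4n}` in the exterior
  have hsep' : ∀ i j : Fin n, i ≠ j → ∃ l : Fin 4, δ ≤ a (sch.β k) * |((x i l - x j l : ℤ) : ℝ)| := by
    intro i j hij; rw [← haeq]; exact hsep i j hij
  have hosc : ∀ η η' : LGConfig 4 G,
      |kerE G r (sch.β k) (fun j => (0 : Fin 4 → ℤ) j - N) (2 * N + 1) η
          (fun U => ∏ i, (r.curvature.F (configShift (-(x i)) U) - wilsonTorusMean r.ρ (sch.β k) (sch.L k) r.curvature.F)) -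
        kerE G r (sch.β k) (fun j => (0 : Fin 4 → ℤ) j - N) (2 * N + 1) η'
          (fun U => ∏ i, (r.curvature.F (configShift (-(x i)) U) - wilsonTorusMean r.ρ (sch.β k) (sch.L k) r.curvature.F))| ≤
        ε₁ * (a (sch.β k)) ^ (4 * n) :=
    fun η η' => H2 η η' _ x hmT (fun i => hdepth i) hsep'
  -- one fixed exterior
  set η₀ : LGConfig 4 G := fun _ => 1 with hη₀
  -- TORUS side
  have hTside := abs_torusE_sub_le_of_kernel G r (sch.β k) 0 N (sch.L k) hN1L hPc hPb hPcyl hwinT (fun η => hosc η η₀)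
  -- CELL side: the one-cube DLR identity, then the same transfer
  have hinj := window_injective_of_period (C k).P (hC k).1 (fun j => (0 : Fin 4 → ℤ) j - (N : ℤ)) (2 * N + 1) hb5
  have hDLR := integral_kerE_cellLift_eq r (C k) (sch.β k) (fun j => (0 : Fin 4 → ℤ) j - (N : ℤ)) (2 * N + 1) hinj
    _ hPc.measurable hPb _ hPcyl hwinC
  have hCside := abs_integral_cellLift_sub_le_of_kernel (C k) r (sch.β k) _ _ hPc hPb hDLR (fun η => hosc η η₀)
  -- combine
  have h2ε : 2 * (ε₁ * (a (sch.β k)) ^ (4 * n)) ≤ ε * (sch.a k) ^ (4 * n) := by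
    rw [← haeq]
    nlinarith [pow_pos hα (4 * n)]
  refine le_trans ?_ h2ε
  calc |(∫ U, ∏ i, (r.curvature.F (configShift (-(x i)) ((C k).lift U)) -
            wilsonTorusMean r.ρ (sch.β k) (sch.L k) r.curvature.F) ∂((C k).measure r.ρ (sch.β k))) -
          (∫ U, ∏ i, (r.curvature.F (configShift (-(x i)) (torusLift (2 * sch.L k + 1) U)) -
            wilsonTorusMean r.ρ (sch.β k) (sch.L k) r.curvature.F)
            ∂(wilsonMeasure (d := 4) (L := 2 * sch.L k + 1) r.ρ (sch.β k)))|
      ≤ |(∫ U, ∏ i, (r.curvature.F (configShift (-(x i)) ((C k).lift U)) -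
            wilsonTorusMean r.ρ (sch.β k) (sch.L k) r.curvature.F) ∂((C k).measure r.ρ (sch.β k))) -
            kerE G r (sch.β k) (fun j => (0 : Fin 4 → ℤ) j - N) (2 * N + 1) η₀
              (fun U => ∏ i, (r.curvature.F (configShift (-(x i)) U) -
                wilsonTorusMean r.ρ (sch.β k) (sch.L k) r.curvature.F))| +
          |kerE G r (sch.β k) (fun j => (0 : Fin 4 → ℤ) j - N) (2 * N + 1) η₀
              (fun U => ∏ i, (r.curvature.F (configShift (-(x i)) U) -
                wilsonTorusMean r.ρ (sch.β k) (sch.L k) r.curvature.F)) -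
            (∫ U, ∏ i, (r.curvature.F (configShift (-(x i)) (torusLift (2 * sch.L k + 1) U)) -
              wilsonTorusMean r.ρ (sch.β k) (sch.L k) r.curvature.F)
              ∂(wilsonMeasure (d := 4) (L := 2 * sch.L k + 1) r.ρ (sch.β k)))| := abs_sub_le _ _ _
    _ ≤ ε₁ * (a (sch.β k)) ^ (4 * n) + ε₁ * (a (sch.β k)) ^ (4 * n) := by
        refine add_le_add hCside ?_
        rw [abs_sub_comm]
        exact hTside
    _ = 2 * (ε₁ * (a (sch.β k)) ^ (4 * n)) := by ring

end Summit.QuantumFields.YangMills.Theorems.RecentredCoverTransfer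

end

/-! ## Registration under the «product-law» skeleton of crux `CommonCentredCoverTransfer` (stmt-QuantumFields-23106)

The registered skeleton `Cruxes/CommonCentredCoverTransfer` («product-law», planner ym-idea-1 g9, LINE g9-B′) names this item as its
stub 2, `Summit.QuantumFields.YangMills.Cruxes.CommonCentredCoverTransfer.ProductLaw.stub_pointwiseTransferOfProductLaw`; recorded here
BY NAME (appended 2026-08-28; previous declarations byte-identical). -/

namespace Summit.QuantumFields.YangMills.Cruxes.CommonCentredCoverTransfer.ProductLaw

/-- **Stub 2 of «product-law» (crux stmt-QuantumFields-23106), BY NAME**: the pointwise moment transfer from the product boundary law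
(= item 23256). [folklore] -/
theorem stub_pointwiseTransferOfProductLaw :
    Summit.QuantumFields.YangMills.Theses.RecentredCoverTransfer.PointwiseTransferOfProductLaw :=
  Summit.QuantumFields.YangMills.Theorems.RecentredCoverTransfer.pointwiseTransferOfProductLaw_proof

end Summit.QuantumFields.YangMills.Cruxes.CommonCentredCoverTransfer.ProductLaw
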